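import Mathlib
import Summits.ValiantsHypothesis.ValiantsHypothesis.Theorems.BarrierLeverDefinableDcEquationsLinearWindow
import Summits.ValiantsHypothesis.ValiantsHypothesis.Theorems.BarrierLeverDefinableEquationsSingularLocusMethodNatural
import HarnessLib

/-!
# Crux `BarrierLever.DefinableDcEquations` (stmt-ValiantsHypothesis-8746) — the `dc` row at
# QUASI-POLYNOMIAL level: Kumar–Volk's FULL reach `dc ≤ n + ⌊(n−7)/2⌋ = ⌊(3n−7)/2⌋` is an
# algebraically natural proof of level `14 (log₂ n + 1) + 11` (val-np-p5 g25)

The `dc`-axis of the 𝒞-side chart (val-np-p5 g0–g2, file `…DefinableDcEquationsLinearWindow`):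
the cell's Macaulay certificate `certPoly n w` on a window of `w ≥ 2k + 7` coordinates vanishes on
`{deg f ≤ n, dc f ≤ n + k}`; at CONSTANT level `14c + 11` (size `poly(N)`, `N = C(2n,n)`) this
reaches every excess `k` with `(2k+7)(log₂ n + 1) ≤ c·n`, i.e. thresholds `n + Θ(c·n / log n)`
(`naturalProofsAgainstDcLinearWindow`).  The singular-locus lower bound in print — Kumar–Volk,
`dc(∑ xᵢⁿ) ≥ 1.5 n − 3` — uses ALL `n` variables.  Taking the full window `w = n` (so
`k = ⌊(n−7)/2⌋`, threshold `n + k = ⌊(3n−7)/2⌋`) and the sharper size count of val-np-p5 g23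
(`SingularLocusMethod.certPoly_self_mem_distinguishers`: `certPoly n n ∈ Distinguishers ℂ n
(14(log₂ n+1)+11)`, size `N^{O(log n)}`) gives the `dc` twin of g23's full-strength statements for
ABPs / Baur–Strassen (`…QuasiLevel.lean`):

* `isNaturalProof_certPoly_dc_full` — for `n ≥ 7`, `certPoly n n` is a natural proof of level
  `14(log₂ n + 1) + 11` against `{f : deg f ≤ n, dc f ≤ n + (n − 7)/2}`;
* `not_isSuccinctHittingSet_dc_full` — hitting-set reading;
* `naturalProofsAgainstDcFull_quasi` — eventually-in-`n` form with the explicit level function.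

Reading: as for ABPs and general circuits (g23), the `log n` that the constant-level statement loses
in the THRESHOLD (`n + Θ(n / log n)` vs. `1.5 n`) reappears as the LEVEL (`O(log n)`, quasi-polynomial
size) when the full printed bound is made natural; a constant-level natural proof of the full
`1.5n − O(1)` needs a non-resultant certificate of `codim Sing ≥ Ω(n)` (open, see the g23/g25 memos).
The crux's own threshold `m(n) ≥ 2^(C (log₂ n + 1)²)` is untouched: 8746 stays OPEN
(Chatterjee–Tengse 2023 §1.3 dir. 2); nothing here bears on `VP ≠ VNP`.  No definitions, no named
facts.  Refs: M. Kumar, B. L. Volk, *A lower bound on determinantal complexity*, cc 2022 §3;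
Forbes–Shpilka–Volk 2018 Def. 1.1 / Thm. 4.
-/

set_option linter.dupNamespace false

noncomputable section

open MvPolynomial Finset Matrix

namespace Summit.ValiantsHypothesis.ValiantsHypothesis.Theorems.BarrierLever.DcConstantExcess

open Literature.Computability.AlgebraicComplexity
open Literature.Barriers.ValiantsHypothesis
open Summit.ValiantsHypothesis.ValiantsHypothesis.Theorems.BarrierLever.NaturalProofsAgainstAllLinearSizes
open Summit.ValiantsHypothesis.ValiantsHypothesis.Theorems.BarrierLeverDefinableEquations.SingularLocusMethod

namespace QuasiLevel

/-- **Kumar–Volk at full reach, level `O(log n)`.**  For `n ≥ 7`, the all-variable Macaulay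
certificate `certPoly n n` is an algebraically natural proof (FSV Def. 1) of level
`14(log₂ n + 1) + 11` against `{f ∈ ℂ[x₁..xₙ] : deg f ≤ n, dc f ≤ n + ⌊(n−7)/2⌋}` — the window
`w = n ≥ 2k + 7` of `eval_certPoly_eq_zero_of_dc_le_add_linear` with `k = ⌊(n−7)/2⌋`, and the
size count `certPoly_self_mem_distinguishers`. [cite: KumarVolk2022b, §3; ForbesShpilkaVolk2018, Def. 1] -/
theorem isNaturalProof_certPoly_dc_full {n : ℕ} (hn : 7 ≤ n) :
    IsNaturalProof (degLEMonomials n)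
      {f : MvPolynomial (Fin n) ℂ | f.totalDegree ≤ n ∧
        determinantalComplexity f ≤ n + (n - 7) / 2}
      (Distinguishers ℂ n (7 * (2 * (Nat.log 2 n + 1)) + 11)) (certPoly n n) := by
  obtain ⟨hmem, hne⟩ := certPoly_self_mem_distinguishers (n := n) (by omega)
  refine ⟨hmem, hne, fun f hf => ?_⟩
  exact eval_certPoly_eq_zero_of_dc_le_add_linear (k := (n - 7) / 2) (w := n) (by omega) (by omega)
    f hf.1 hf.2

/-- **Hitting-set reading.**  For `n ≥ 7`, `{deg f ≤ n, dc f ≤ n + ⌊(n−7)/2⌋}` is NOT a succinct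
hitting set for `Distinguishers ℂ n (14(log₂ n + 1) + 11)`. [cite: ForbesShpilkaVolk2018, Thm. 4] -/
theorem not_isSuccinctHittingSet_dc_full {n : ℕ} (hn : 7 ≤ n) :
    ¬ IsSuccinctHittingSet (degLEMonomials n)
      {f : MvPolynomial (Fin n) ℂ | f.totalDegree ≤ n ∧
        determinantalComplexity f ≤ n + (n - 7) / 2}
      (Distinguishers ℂ n (7 * (2 * (Nat.log 2 n + 1)) + 11)) := by
  rw [← exists_isNaturalProof_iff]
  exact ⟨certPoly n n, isNaturalProof_certPoly_dc_full hn⟩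

/-- **Eventually form with the explicit (logarithmic) level function.**  There is `n₀` such that
for every `n ≥ n₀` and every `k` with `2k + 7 ≤ n` the slice `{deg f ≤ n, dc f ≤ n + k}` is killed
by the level-`(14(log₂ n + 1) + 11)` distinguisher `certPoly n n` (`q = 0`; quasi-polynomial size —
NOT a constant FSV level: the constant-level range is `…LinearWindow.naturalProofsAgainstDcLinearWindow`).
[cite: KumarVolk2022b, §3; ForbesShpilkaVolk2018, Def. 1] -/
theorem naturalProofsAgainstDcFull_quasi :
    ∃ n₀ : ℕ, ∀ n ≥ n₀, ∀ k : ℕ, 2 * k + 7 ≤ n →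
      IsNaturalProof (degLEMonomials n)
        {f : MvPolynomial (Fin n) ℂ | f.totalDegree ≤ n ∧ determinantalComplexity f ≤ n + k}
        (Distinguishers ℂ n (7 * (2 * (Nat.log 2 n + 1)) + 11)) (certPoly n n) := by
  refine ⟨7, fun n hn k hk => ?_⟩
  obtain ⟨hmem, hne⟩ := certPoly_self_mem_distinguishers (n := n) (by omega)
  exact ⟨hmem, hne, fun f hf =>
    eval_certPoly_eq_zero_of_dc_le_add_linear (k := k) (w := n) hk (by omega) f hf.1 hf.2⟩

/-- **The two regimes of the `dc` row side by side** (constant level vs. full reach): (i) for every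
`c`, ONE constant level `14c + 11` kills `dc ≤ n + k` for all `n ≥ 2^c` and all `k` with
`(2k+7)(log₂ n + 1) ≤ c·n` (tree, `naturalProofsAgainstDcLinearWindow`); (ii) the full printed
reach `k = ⌊(n−7)/2⌋` is killed at level `14(log₂ n + 1) + 11` (this file). [cite: KumarVolk2022b, §3] -/
theorem dc_row_regimes (c : ℕ) :
    (∃ a n₀ : ℕ, ∀ n ≥ n₀, ∀ k : ℕ, (2 * k + 7) * (Nat.log 2 n + 1) ≤ c * n →
      ¬ IsSuccinctHittingSet (degLEMonomials n)
        {f : MvPolynomial (Fin n) ℂ | f.totalDegree ≤ n ∧ determinantalComplexity f ≤ n + k}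
        (Distinguishers ℂ n a)) ∧
    (∀ n : ℕ, 7 ≤ n →
      ¬ IsSuccinctHittingSet (degLEMonomials n)
        {f : MvPolynomial (Fin n) ℂ | f.totalDegree ≤ n ∧
          determinantalComplexity f ≤ n + (n - 7) / 2}
        (Distinguishers ℂ n (7 * (2 * (Nat.log 2 n + 1)) + 11))) :=
  ⟨naturalProofsAgainstDcLinearWindow c, fun _ hn => not_isSuccinctHittingSet_dc_full hn⟩

end QuasiLevel

end Summit.ValiantsHypothesis.ValiantsHypothesis.Theorems.BarrierLever.DcConstantExcess
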